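import Summits.Langlands.Langlands.Theorems.ParityBlindBianchiArtinWeightRealisationEvenPinnedRealisation
import Summits.Langlands.Langlands.Theorems.ParityBlindBianchiArtinWeightRealisationLevelRigidity
import Literature.NumberTheory.Automorphic.ArchHeckeTestVectorGammaGL2
import HarnessLib

/-!
# Pinned realisation from ALMOST-EVERYWHERE data — the `a.e.` form of the checkable half of the line
# `SketchIdeator2` for the crux `ParityBlindBianchi.ArtinWeightRealisationEven` (item stmt-Langlands-16619)

Helper file (`--supports stmt-Langlands-16619`).  The landed `stub_pinnedRealisation` (p155346) pins a cuspidal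
`π` which is, at EVERY good place, Satake–Frobenius compatible with some framed `r` and sign-blind compatible with
the finite-image icosahedral `σ`.  Jacquet–Langlands rigidity is a THEOREM of the tree
(`ArtinWeightRealisationLevel.satakeFrobCompatibleAt_of_eventually_of_isUnramifiedAt`, whose displayed
hypothesis — Gelbart 1997, Prop. 4.1 at the `σ`-unramified places — is the landed
`frobSatakeCompatibleAt_of_isUnramifiedAt_of_archKirillovGammaProduct'`, i.e. Jacquet–Langlands 1970,
Thm. 11.1 / Cor. 11.2 / proof of Thm. 12.2, proved in the tree), so both inputs may be weakened to hold only at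
all but finitely many places:

* `good_of_good_union_image_absNorm` — enlarging `S₀` by the absolute norms of a finite set `E` of places
  gives a finite `S₁ ⊇ S₀`, still with `0 ∉ S₁`, whose good places are good for `S₀` and avoid `E`;
* `eventually_good` — the good places of any finite `S₁` with `0 ∉ S₁` form a cofinite set;
* `realisation_of_eventually` — if `π` is compatible with `r` and sign-blind compatible with `σ` at all but
  finitely many places, and `σ` is unramified at every good place, then some cuspidal `π'` is Satake–Frobenius
  compatible with `σ` at EVERY good place.

With it the line reads `R″ ⟸ S1ae ∧ S2ae ∧ S7`, where S1ae/S2ae are the almost-everywhere weakenings of the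
open stubs S1 (`stub_adjointHost`) and S2 (`stub_classicalOccurrence`).  No definition, no named fact.
-/

-- the line's namespace `Summit.Langlands.Langlands.…` (summit = problem = `Langlands`) repeats a
-- component by design
set_option linter.dupNamespace false

namespace Summit.Langlands.Langlands.Theorems.ArtinWeightRealisationEven

open scoped MatrixGroups Matrix Polynomial NumberField
open NumberField IsDedekindDomain Polynomial Field Filter
open Literature.NumberTheory.Automorphic Literature.NumberTheory.GaloisRepresentations

/-- Enlarging a finite set `S₀` of naturals (`0 ∉ S₀`) by the absolute norms of a finite set `E` of finite
places of a number field `K` gives a finite `S₁` with `0 ∉ S₁` whose good places (places above no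
`ℓ ∈ S₁`) are good for `S₀` and lie outside `E` (`Ideal.absNorm_mem`: `N(w) ∈ w`; `Ideal.absNorm_eq_zero_iff`:
`N(w) ≠ 0`). -/
theorem good_of_good_union_image_absNorm (K : Type) [Field K] [NumberField K] (S₀ : Finset ℕ)
    (h0 : (0 : ℕ) ∉ S₀) (E : Set (HeightOneSpectrum (𝓞 K))) (hE : E.Finite) :
    ∃ S₁ : Finset ℕ, (0 : ℕ) ∉ S₁ ∧ S₀ ⊆ S₁ ∧
      ∀ w : HeightOneSpectrum (𝓞 K), (∀ ℓ ∈ S₁, ((ℓ : ℕ) : 𝓞 K) ∉ w.asIdeal) →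
        (∀ ℓ ∈ S₀, ((ℓ : ℕ) : 𝓞 K) ∉ w.asIdeal) ∧ w ∉ E := by
  classical
  refine ⟨S₀ ∪ hE.toFinset.image (fun w => Ideal.absNorm w.asIdeal), ?_, Finset.subset_union_left, ?_⟩
  · intro hmem
    rcases Finset.mem_union.mp hmem with h | h
    · exact h0 h
    · obtain ⟨w, -, hw⟩ := Finset.mem_image.mp h
      exact w.ne_bot (Ideal.absNorm_eq_zero_iff.mp hw)
  · intro w hw
    refine ⟨fun ℓ hℓ => hw ℓ (Finset.mem_union_left _ hℓ), fun hwE => ?_⟩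
    have hmem : Ideal.absNorm w.asIdeal ∈ S₀ ∪ hE.toFinset.image (fun w => Ideal.absNorm w.asIdeal) :=
      Finset.mem_union_right _ (Finset.mem_image.mpr ⟨w, hE.mem_toFinset.mpr hwE, rfl⟩)
    exact hw _ hmem (Ideal.absNorm_mem w.asIdeal)

/-- The good places of a finite set `S₁` of naturals with `0 ∉ S₁` are all but finitely many places
(`finite_setOf_exists_natCast_mem_asIdeal`). -/
theorem eventually_good (K : Type) [Field K] [NumberField K] (S₁ : Finset ℕ) (h0 : (0 : ℕ) ∉ S₁) :
    ∀ᶠ w : HeightOneSpectrum (𝓞 K) in cofinite, ∀ ℓ ∈ S₁, ((ℓ : ℕ) : 𝓞 K) ∉ w.asIdeal := by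
  refine (finite_setOf_exists_natCast_mem_asIdeal K S₁ h0).eventually_cofinite_notMem.mono ?_
  intro w hw ℓ hℓ hmem
  exact hw ⟨ℓ, hℓ, hmem⟩

/-- **Pinned realisation from almost-everywhere data.**  For a number field `K`, `ι : ℚ̄_p ≃ ℂ`, a
finite-image `σ : Γ_K → GL₂(ℚ̄_p)` with projective image `A₅`, a finite `S₀` with `0 ∉ S₀`, a cuspidal `π` of
`GL₂(𝔸_K)` and a framed `r`: if `σ` is unramified at every good place and, at all but finitely many places,
`π` is Satake–Frobenius compatible with `r` and compatible with `σ` up to the sign of the trace, then some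
cuspidal `π'` is Satake–Frobenius compatible with `σ` at EVERY good place.  Proof: enlarge `S₀` past the
exceptional places (`good_of_good_union_image_absNorm`), pin and twist there (`stub_pinnedRealisation`), and
return to every good place by Jacquet–Langlands rigidity
(`satakeFrobCompatibleAt_of_eventually_of_isUnramifiedAt` with
`frobSatakeCompatibleAt_of_isUnramifiedAt_of_archKirillovGammaProduct'`). -/
theorem realisation_of_eventually :
    ∀ (K : Type) [Field K] [NumberField K] (p : ℕ) [Fact p.Prime] (ι : PadicAlgCl p ≃+* ℂ)
      (σ r : FramedGaloisRep K (PadicAlgCl p) 2), Finite σ.toMonoidHom.range →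
      Nonempty ((Matrix.ProjGenLinGroup.mk.comp σ.toMonoidHom).range ≃* alternatingGroup (Fin 5)) →
      ∀ (S₀ : Finset ℕ), (0 : ℕ) ∉ S₀ →
      (∀ w : HeightOneSpectrum (𝓞 K), (∀ ℓ ∈ S₀, ((ℓ : ℕ) : 𝓞 K) ∉ w.asIdeal) → σ.IsUnramifiedAt w) →
      ∀ (hcpt : isCompact_glFiniteIntegralLevel 2 K) (π : CuspidalAutomorphicRepData 2 K hcpt),
      (∀ᶠ w : HeightOneSpectrum (𝓞 K) in cofinite,
        (∃ α : Multiset ℂ, π.1.HasSatakeParamAt w α ∧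
          (σ.HasFrobCharpolyAt w (arithFrobPolyOfSatake ι w.residueCard 1 α) ∨
           σ.HasFrobCharpolyAt w ((arithFrobPolyOfSatake ι w.residueCard 1 α).comp (-X)))) ∧
        SatakeFrobCompatibleAt ι π.1 r w) →
      ∃ (hcpt' : isCompact_glFiniteIntegralLevel 2 K) (π' : CuspidalAutomorphicRepData 2 K hcpt'),
        ∀ w : HeightOneSpectrum (𝓞 K), (∀ ℓ ∈ S₀, ((ℓ : ℕ) : 𝓞 K) ∉ w.asIdeal) →
          SatakeFrobCompatibleAt ι π'.1 σ w := by
  intro K _ _ p _ ι σ r hσfin hσA5 S₀ h0 hunr hcpt π hae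
  -- the exceptional set is finite; enlarge `S₀` past it
  obtain ⟨S₁, h01, h01sub, hgood⟩ :=
    good_of_good_union_image_absNorm K S₀ h0 _ (Filter.eventually_cofinite.mp hae)
  -- pin and twist at the `S₁`-good places
  obtain ⟨hcpt', π', hπ'⟩ := stub_pinnedRealisation K p ι σ r hσfin hσA5 S₁ h01 hcpt π (fun w hw => by
    obtain ⟨hw0, hwE⟩ := hgood w hw
    have h := Classical.not_not.mp hwE
    obtain ⟨⟨α, hα, hor⟩, hr⟩ := h
    exact ⟨⟨α, hα, hunr w hw0, hor⟩, hr⟩)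
  -- the `S₁`-good places are cofinite: rigidity returns every `σ`-unramified place
  refine ⟨hcpt', π', fun w hw => ?_⟩
  have hev : ∀ᶠ w : HeightOneSpectrum (𝓞 K) in cofinite, SatakeFrobCompatibleAt ι π'.1 σ w :=
    (eventually_good K S₁ h01).mono hπ'
  exact ArtinWeightRealisationLevel.satakeFrobCompatibleAt_of_eventually_of_isUnramifiedAt
    frobSatakeCompatibleAt_of_isUnramifiedAt_of_archKirillovGammaProduct' K p ι σ hσfin hcpt' π' hev w
    (hunr w hw)

end Summit.Langlands.Langlands.Theorems.ArtinWeightRealisationEven
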